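/-
Copyright (c) 2026 the pub-hodgecm-mathlib formalisation cell (harness21).  Prover seat hodgecm-mathlib-R90-C131-p02 (g0) (R90-TF S4 hand lent to L1
by CHAIR VALVE WORD W4), Track B «K2-LIT», hLiu418 = `stmt-HodgeConjecture-24832`; K1-a♮ line lead K2E5-p16 (g8) DESK NAME 01:27Z «(iii-b-3)», FILE 3⁻ (negative index).
THEOREMS ONLY (no `def`, no instance, no notation, no named-fact hypothesis, no `sorry`); lane `--supports stmt-HodgeConjecture-24832 --as helper`.
-/
import Summits.HodgeConjecture.HodgeConjecture.Theorems.K2LiuArchTwistedScalarBlockRayDerivNeg     -- ★ FILE 2b⁻: the ray derivative of the negative-index explicit letter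
import Summits.HodgeConjecture.HodgeConjecture.Theorems.K2LiuArchTwistedScalarBlockExplicitNeg     -- ★ p864005 (iii-a⁻)
import Summits.HodgeConjecture.HodgeConjecture.Theorems.K2LiuArchLadderRungTransfer               -- ★ `anchor`: `f⁰_{s,k}` is a Siegel section with picture `dz (−k)`
import Summits.HodgeConjecture.HodgeConjecture.Theorems.K2LiuKindWArchWhittakerHolomorphy         -- ★ `norm_cexp_trace_hermOfReal` (the character has modulus 1)
import HarnessLib

/-!
# Crux `HLiu418`, (Φ-S1) road B, (iii-b-3) FILE 3⁻: the FIRST NON-SCALAR RUNG at a NEGATIVE rank-one index `−a·diag(t,0)·aᴴ` — the archimedean place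
# letters `(A, Ac, hAc, hA)` of ★ p863286 §2 for `D_X f⁰_{s,k}`, jointly in the point (sign twin of FILE 3)

Cell `hodgecm-mathlib`, crux item hLiu418 = `stmt-HodgeConjecture-24832` (helper lane, count-neutral).  The template the next seat iterates along ★
`ladder_pair_from`'s word: the `K_w`-type rungs are `D_X F = y ↦ d/dτ|₀ F(y·exp(τX))` (★ `rung_pair`).  For `F = f⁰_{s,k}`:
(1) ★ p863633 `integrable_and_hasDerivAt_twisted_rayDeriv`: the twisted block of `D_X f⁰` at `h` is `d/dτ|₀` of the twisted block of `f⁰` at `h·exp(τX)`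
(`re s > ½`; the character `e(−τ(T·X_r))` is a continuous weight of modulus `1`, ★ `norm_cexp_trace_hermOfReal`);
(2) ★ p863574 `twistedArchBlock_scalarType_eq_continued`: on `U(J)` the twisted block of `f⁰` IS the explicit letter (with ★ (ii)'s universal `Φ` and the
weight coordinates read off `aᴴ(2V)a`), so the two `τ`-functions coincide;
(3) ★ FILE 2b `exists_hasDerivAt_continuedFormula_ray`: the explicit letter has a `τ`-derivative `Dv h s` at `0`, holomorphic in `s` on `{0 < re s}`;
(4) uniqueness of derivatives: the twisted block of `D_X f⁰` equals `Dv h s` for `re s > ½`.  Hence `Ac₁ s h := Dv h s` are the letters.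
* §1 **`exists_archLetters_rung_neg`** (over ★ p864005 `twistedArchBlock_scalarType_eq_continued_neg` and ★ FILE 2b⁻).

HONEST LABEL: one rung above the scalar type, negative index; the general word is the sequel; closes no socket.  HC_CM is proved only modulo the 7 printed citations (2 remaining named inputs: hLiu418 = `stmt-HodgeConjecture-24832`,
h413 = `stmt-HodgeConjecture-24833`) until rung 0 closes.  REL ≠ ★ ≠ BUILT.

## References
* [Knapp1986] A. W. Knapp, *Representation Theory of Semisimple Groups*, Princeton (1986), Ch. VIII §3.
* [LeeZhu1998] S. T. Lee, C.-B. Zhu, *Degenerate principal series and local theta correspondence II*, Israel J. Math. 100 (1997/98), §5.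
* [Shimura1982] G. Shimura, *Confluent hypergeometric functions on tube domains*, Math. Ann. 260 (1982), §4 Thm. 4.2.
-/

set_option autoImplicit false
set_option linter.dupNamespace false

noncomputable section

open Complex Matrix NormedSpace MeasureTheory Set
open scoped ComplexConjugate ComplexOrder

namespace Summit.HodgeConjecture.HodgeConjecture.Cruxes.HLiu418.K2LiuArchTwistedKTypeBlockRungNeg

open Literature.NumberTheory.ModularForms.SiegelUpperHalfSpace (num denom moeb)
open Summit.HodgeConjecture.HodgeConjecture.Cruxes.HLiu418.K2LiuHermTwoGammaDefs
open Summit.HodgeConjecture.HodgeConjecture.Cruxes.HLiu418.K2LiuHermTwoEtaDefs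
open Summit.HodgeConjecture.HodgeConjecture.Cruxes.HLiu418.K2LiuHermitianTubeCocycle (mul_mem_UJ isUnit_det_denom posDef_im_moeb posDef_im_I_smul_one)
open Summit.HodgeConjecture.HodgeConjecture.Cruxes.HLiu418.K2LiuArchInducedTubeDefs
open Summit.HodgeConjecture.HodgeConjecture.Cruxes.HLiu418.K2LiuU22CompactPictureDefs
open Summit.HodgeConjecture.HodgeConjecture.Cruxes.HLiu418.K2LiuLieRayDifferentiability (conjTranspose_exp_mul_J_mul_exp)
open Summit.HodgeConjecture.HodgeConjecture.Cruxes.HLiu418.K2LiuArchIntertwiningLieDerivativePrelims (continuous_hermOfReal isHermitian_hermOfReal)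
open Summit.HodgeConjecture.HodgeConjecture.Cruxes.HLiu418.K2LiuArchTwistedIntertwiningKFiniteSwap
open Summit.HodgeConjecture.HodgeConjecture.Cruxes.HLiu418.K2LiuArchTwistedScalarBlockParamSmooth
open Summit.HodgeConjecture.HodgeConjecture.Cruxes.HLiu418.K2LiuArchTwistedScalarBlockExplicitNeg
open Summit.HodgeConjecture.HodgeConjecture.Cruxes.HLiu418.K2LiuArchTwistedScalarBlockRayDerivNeg
open Summit.HodgeConjecture.HodgeConjecture.Cruxes.HLiu418.K2LiuArchLadderRungTransfer (anchor)
open Summit.HodgeConjecture.HodgeConjecture.Cruxes.HLiu418.K2LiuKindWArchWhittakerHolomorphy (norm_cexp_trace_hermOfReal)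

/-! ## §1 The letters of the first rung, negative index -/

set_option maxHeartbeats 800000 in
/-- **THE ARCH LETTERS OF THE FIRST NON-SCALAR RUNG `D_X f⁰_{s,k}`, NEGATIVE INDEX** (`X = C·(αβγδ)·C′ ∈ 𝔲(J)`, index `−a·diag(t,0)·aᴴ`, `‖det a‖ = 1`,
`t > 0`, `−k/2 < N`): ONE function `Ac₁ s h`, holomorphic in `s` on `{0 < re s}` at every `h ∈ U(J)`, with
`∫ e(−τ(T·X_r)) (D_X f⁰_{s,k})(J n(X_r) h) dr = Ac₁ s h` for `½ < re s`, `h ∈ U(J)` — the binders `(Ac) (hAc) (hA)` of ★ p863286 §2 for this `K_w`-type vector.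
[Knapp1986, Ch. VIII §3] [LeeZhu1998, §5] [Shimura1982, §4 Thm. 4.2] -/
theorem exists_archLetters_rung_neg (k : ℤ) (α β γ δ : Matrix (Fin 2) (Fin 2) ℂ)
    (hX : (fromBlocks 1 1 (I • 1) (-(I • 1)) * fromBlocks α β γ δ * ((2 : ℂ)⁻¹ • fromBlocks 1 (-(I • 1)) 1 (I • 1)) : Matrix (Fin 2 ⊕ Fin 2) (Fin 2 ⊕ Fin 2) ℂ)ᴴ * Matrix.J (Fin 2) ℂ + Matrix.J (Fin 2) ℂ * (fromBlocks 1 1 (I • 1) (-(I • 1)) * fromBlocks α β γ δ * ((2 : ℂ)⁻¹ • fromBlocks 1 (-(I • 1)) 1 (I • 1)) : Matrix (Fin 2 ⊕ Fin 2) (Fin 2 ⊕ Fin 2) ℂ) = 0)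
    {a : Matrix (Fin 2) (Fin 2) ℂ} (hdet : ‖a.det‖ = 1) {t : ℝ} (ht : 0 < t) {N : ℕ} (hN : -(k : ℝ) / 2 < N) :
    ∃ Ac₁ : ℂ → Matrix (Fin 2 ⊕ Fin 2) (Fin 2 ⊕ Fin 2) ℂ → ℂ,
      (∀ h : Matrix (Fin 2 ⊕ Fin 2) (Fin 2 ⊕ Fin 2) ℂ, hᴴ * Matrix.J (Fin 2) ℂ * h = Matrix.J (Fin 2) ℂ →
        DifferentiableOn ℂ (fun s => Ac₁ s h) {s : ℂ | 0 < s.re}) ∧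
      (∀ s : ℂ, 1 / 2 < s.re → ∀ h : Matrix (Fin 2 ⊕ Fin 2) (Fin 2 ⊕ Fin 2) ℂ, hᴴ * Matrix.J (Fin 2) ℂ * h = Matrix.J (Fin 2) ℂ →
        (∫ r : Fin 2 → Fin 2 → ℝ, cexp (-(2 * Real.pi * I) * ((-(a * hermTwo (t, 0, 0) * aᴴ)) * hermOfReal r).trace) *
          (fun y : Matrix (Fin 2 ⊕ Fin 2) (Fin 2 ⊕ Fin 2) ℂ => deriv (fun τ : ℝ => archScalarSection k s (y * NormedSpace.exp (τ • (fromBlocks 1 1 (I • 1) (-(I • 1)) * fromBlocks α β γ δ * ((2 : ℂ)⁻¹ • fromBlocks 1 (-(I • 1)) 1 (I • 1)) : Matrix (Fin 2 ⊕ Fin 2) (Fin 2 ⊕ Fin 2) ℂ)))) 0)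
            (Matrix.J (Fin 2) ℂ * fromBlocks 1 (hermOfReal r) 0 1 * h)) = Ac₁ s h) := by
  have ha0 : a.det ≠ 0 := fun h0 => by rw [h0, norm_zero] at hdet; exact zero_ne_one hdet
  have haU : IsUnit a := (Matrix.isUnit_iff_isUnit_det a).mpr (Ne.isUnit ha0)
  have hπt : 0 < Real.pi * t := by positivity
  obtain ⟨Φ, hΦa, hΦb, -, hΦd⟩ := exists_continuation_jIntegral_param hπt N
  -- the ray derivative of the explicit letter at every point of `U(J)` (★ FILE 2b), chosen jointly in the point
  choose! Dv hDvhol hDv using fun (h : Matrix (Fin 2 ⊕ Fin 2) (Fin 2 ⊕ Fin 2) ℂ) (hh : hᴴ * Matrix.J (Fin 2) ℂ * h = Matrix.J (Fin 2) ℂ) =>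
    exists_hasDerivAt_continuedFormula_ray_neg k hh hX hdet t hN Φ hΦa hΦd
  refine ⟨fun s h => Dv h s, fun h hh => hDvhol h hh, fun s hs h hh => ?_⟩
  have hs0 : 0 < s.re := by linarith
  -- the weight `e(−τ(T·X_r))`: continuous, modulus one
  have hTh : (-(a * hermTwo (t, 0, 0) * aᴴ))ᴴ = -(a * hermTwo (t, 0, 0) * aᴴ) := (isHermitian_mul_mul_conjTranspose a (isHermitian_hermTwo _)).neg.eq
  have hwc : Continuous fun r : Fin 2 → Fin 2 → ℝ => cexp (-(2 * Real.pi * I) * ((-(a * hermTwo (t, 0, 0) * aᴴ)) * hermOfReal r).trace) := by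
    refine Complex.continuous_exp.comp (continuous_const.mul ?_)
    have hm : Continuous fun r : Fin 2 → Fin 2 → ℝ => (-(a * hermTwo (t, 0, 0) * aᴴ)) * hermOfReal r := continuous_const.mul continuous_hermOfReal
    exact (Matrix.traceLinearMap (Fin 2) ℂ ℂ).continuous_of_finiteDimensional.comp hm
  have hw : ∀ r : Fin 2 → Fin 2 → ℝ, ‖cexp (-(2 * Real.pi * I) * ((-(a * hermTwo (t, 0, 0) * aᴴ)) * hermOfReal r).trace)‖ ≤ 1 :=
    fun r => (norm_cexp_trace_hermOfReal hTh r).le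
  -- (1) the swap: block of `D_X f⁰` at `h` = `d/dτ|₀` block of `f⁰` at `h·exp(τX)`
  obtain ⟨hF, hFQ, -⟩ := anchor k hs
  obtain ⟨-, hswap⟩ := integrable_and_hasDerivAt_twisted_rayDeriv k hs hF (dz (-k)) hFQ α β γ δ hX hh _ hwc hw
  -- (2) on `U(J)` the block of `f⁰` IS the explicit letter, so along the ray the two `τ`-functions coincide; (3) FILE 2b differentiates the letter
  have hray := hDv h hh s hs0
  have heq : ∀ τ : ℝ, (∫ r : Fin 2 → Fin 2 → ℝ, cexp (-(2 * Real.pi * I) * ((-(a * hermTwo (t, 0, 0) * aᴴ)) * hermOfReal r).trace) *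
      archScalarSection k s (Matrix.J (Fin 2) ℂ * fromBlocks 1 (hermOfReal r) 0 1 * (h * NormedSpace.exp (τ • (fromBlocks 1 1 (I • 1) (-(I • 1)) * fromBlocks α β γ δ * ((2 : ℂ)⁻¹ • fromBlocks 1 (-(I • 1)) 1 (I • 1)) : Matrix (Fin 2 ⊕ Fin 2) (Fin 2 ⊕ Fin 2) ℂ))))) =
      ((denom (h * NormedSpace.exp (τ • (fromBlocks 1 1 (I • 1) (-(I • 1)) * fromBlocks α β γ δ * ((2 : ℂ)⁻¹ • fromBlocks 1 (-(I • 1)) 1 (I • 1)) : Matrix (Fin 2 ⊕ Fin 2) (Fin 2 ⊕ Fin 2) ℂ))) (I • (1 : Matrix (Fin 2) (Fin 2) ℂ))).det ^ (-k) *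
          (((‖(denom (h * NormedSpace.exp (τ • (fromBlocks 1 1 (I • 1) (-(I • 1)) * fromBlocks α β γ δ * ((2 : ℂ)⁻¹ • fromBlocks 1 (-(I • 1)) 1 (I • 1)) : Matrix (Fin 2 ⊕ Fin 2) (Fin 2 ⊕ Fin 2) ℂ))) (I • (1 : Matrix (Fin 2) (Fin 2) ℂ))).det‖ : ℝ)) : ℂ) ^ ((k : ℂ) - 2 * s - 2) *
          cexp ((2 * Real.pi * I) * ((-(a * hermTwo (t, 0, 0) * aᴴ)) * ((2 : ℂ)⁻¹ • (moeb (h * NormedSpace.exp (τ • (fromBlocks 1 1 (I • 1) (-(I • 1)) * fromBlocks α β γ δ * ((2 : ℂ)⁻¹ • fromBlocks 1 (-(I • 1)) 1 (I • 1)) : Matrix (Fin 2 ⊕ Fin 2) (Fin 2 ⊕ Fin 2) ℂ))) (I • (1 : Matrix (Fin 2) (Fin 2) ℂ)) + (moeb (h * NormedSpace.exp (τ • (fromBlocks 1 1 (I • 1) (-(I • 1)) * fromBlocks α β γ δ * ((2 : ℂ)⁻¹ • fromBlocks 1 (-(I • 1)) 1 (I • 1)) : Matrix (Fin 2 ⊕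 Fin 2) (Fin 2 ⊕ Fin 2) ℂ))) (I • (1 : Matrix (Fin 2) (Fin 2) ℂ)))ᴴ))).trace)) *
        ((1 / 8 : ℂ) * ((((4 * Real.pi ^ 4 : ℝ)) : ℂ) * cexp ((Real.pi * I) * ((s + 1 - k / 2) - (s + 1 + k / 2))) *
          ((Real.pi : ℂ)⁻¹ * (Complex.Gamma (s + 1 + k / 2))⁻¹) *
          ((Real.pi : ℂ)⁻¹ * (Complex.Gamma (s + 1 - k / 2))⁻¹ * (Complex.Gamma (s + 1 - k / 2 - 1))⁻¹) *
          ((Real.pi : ℂ) / (((aᴴ * ((2 : ℂ) • ((2 * I)⁻¹ • (moeb (h * NormedSpace.exp (τ • (fromBlocks 1 1 (I • 1) (-(I • 1)) * fromBlocks α β γ δ * ((2 : ℂ)⁻¹ • fromBlocks 1 (-(I • 1)) 1 (I • 1)) : Matrix (Fin 2 ⊕ Fin 2) (Fin 2 ⊕ Fin 2) ℂ))) (I • (1 : Matrix (Fin 2) (Fin 2) ℂ)) - (moeb (h * NormedSpace.exp (τ • (fromBlocks 1 1 (I • 1) (-(I • 1)) * fromBlocks α β γ δ * ((2 : ℂ)⁻¹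 • fromBlocks 1 (-(I • 1)) 1 (I • 1)) : Matrix (Fin 2 ⊕ Fin 2) (Fin 2 ⊕ Fin 2) ℂ))) (I • (1 : Matrix (Fin 2) (Fin 2) ℂ)))ᴴ))) * a) 0 0).re) * cexp (-(((((aᴴ * ((2 : ℂ) • ((2 * I)⁻¹ • (moeb (h * NormedSpace.exp (τ • (fromBlocks 1 1 (I • 1) (-(I • 1)) * fromBlocks α β γ δ * ((2 : ℂ)⁻¹ • fromBlocks 1 (-(I • 1)) 1 (I • 1)) : Matrix (Fin 2 ⊕ Fin 2) (Fin 2 ⊕ Fin 2) ℂ))) (I • (1 : Matrix (Fin 2) (Fin 2) ℂ)) - (moeb (h * NormedSpace.exp (τ • (fromBlocks 1 1 (I • 1) (-(I • 1)) * fromBlocks α β γ δ * ((2 : ℂ)⁻¹ • fromBlocks 1 (-(I • 1)) 1 (I • 1)) : Matrix (Fin 2 ⊕ Fin 2) (Fin 2 ⊕ Fin 2) ℂ))) (I • (1 : Matrix (Fin 2) (Fin 2) ℂ)))ᴴ))) * a) 0 0).re) * (Real.pi * t) : ℝ) : ℂ)) *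
            ((1 / (((((aᴴ * ((2 : ℂ) • ((2 * I)⁻¹ • (moeb (h * NormedSpace.exp (τ • (fromBlocks 1 1 (I • 1) (-(I • 1)) * fromBlocks α β γ δ * ((2 : ℂ)⁻¹ • fromBlocks 1 (-(I • 1)) 1 (I • 1)) : Matrix (Fin 2 ⊕ Fin 2) (Fin 2 ⊕ Fin 2) ℂ))) (I • (1 : Matrix (Fin 2) (Fin 2) ℂ)) - (moeb (h * NormedSpace.exp (τ • (fromBlocks 1 1 (I • 1) (-(I • 1)) * fromBlocks α β γ δ * ((2 : ℂ)⁻¹ • fromBlocks 1 (-(I • 1)) 1 (I • 1)) : Matrix (Fin 2 ⊕ Fin 2) (Fin 2 ⊕ Fin 2) ℂ))) (I • (1 : Matrix (Fin 2) (Fin 2) ℂ)))ᴴ))) * a) 1 1).re) - normSq ((aᴴ * ((2 : ℂ) • ((2 * I)⁻¹ • (moeb (h * NormedSpace.exp (τ • (fromBlocks 1 1 (I • 1) (-(I • 1)) * fromBlocks α β γ δ * ((2 : ℂ)⁻¹ • fromBlocks 1 (-(I • 1)) 1 (I • 1)) : Matrix (Fin 2 ⊕ Fin 2) (Fin 2 ⊕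 Fin 2) ℂ))) (I • (1 : Matrix (Fin 2) (Fin 2) ℂ)) - (moeb (h * NormedSpace.exp (τ • (fromBlocks 1 1 (I • 1) (-(I • 1)) * fromBlocks α β γ δ * ((2 : ℂ)⁻¹ • fromBlocks 1 (-(I • 1)) 1 (I • 1)) : Matrix (Fin 2 ⊕ Fin 2) (Fin 2 ⊕ Fin 2) ℂ))) (I • (1 : Matrix (Fin 2) (Fin 2) ℂ)))ᴴ))) * a) 0 1) / (((aᴴ * ((2 : ℂ) • ((2 * I)⁻¹ • (moeb (h * NormedSpace.exp (τ • (fromBlocks 1 1 (I • 1) (-(I • 1)) * fromBlocks α β γ δ * ((2 : ℂ)⁻¹ • fromBlocks 1 (-(I • 1)) 1 (I • 1)) : Matrix (Fin 2 ⊕ Fin 2) (Fin 2 ⊕ Fin 2) ℂ))) (I • (1 : Matrix (Fin 2) (Fin 2) ℂ)) - (moeb (h * NormedSpace.exp (τ • (fromBlocks 1 1 (I • 1) (-(I • 1)) * fromBlocks α β γ δ * ((2 : ℂ)⁻¹ • fromBlocks 1 (-(I • 1)) 1 (I • 1)) : Matrix (Fin 2 ⊕ Fin 2) (Fin 2 ⊕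 Fin 2) ℂ))) (I • (1 : Matrix (Fin 2) (Fin 2) ℂ)))ᴴ))) * a) 0 0).re) : ℝ) : ℂ)) ^ ((s + 1 - k / 2) + (s + 1 + k / 2) - 2) * Complex.Gamma (2 * s)) *
          Φ (1 - k / 2) (1 + k / 2) (((aᴴ * ((2 : ℂ) • ((2 * I)⁻¹ • (moeb (h * NormedSpace.exp (τ • (fromBlocks 1 1 (I • 1) (-(I • 1)) * fromBlocks α β γ δ * ((2 : ℂ)⁻¹ • fromBlocks 1 (-(I • 1)) 1 (I • 1)) : Matrix (Fin 2 ⊕ Fin 2) (Fin 2 ⊕ Fin 2) ℂ))) (I • (1 : Matrix (Fin 2) (Fin 2) ℂ)) - (moeb (h * NormedSpace.exp (τ • (fromBlocks 1 1 (I • 1) (-(I • 1)) * fromBlocks α β γ δ * ((2 : ℂ)⁻¹ • fromBlocks 1 (-(I • 1)) 1 (I • 1)) : Matrix (Fin 2 ⊕ Fin 2) (Fin 2 ⊕ Fin 2) ℂ))) (I • (1 : Matrix (Fin 2) (Fin 2) ℂ)))ᴴ))) * a) 0 0).re) s))) := fun τ => by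
    have hhτ : (h * NormedSpace.exp (τ • (fromBlocks 1 1 (I • 1) (-(I • 1)) * fromBlocks α β γ δ * ((2 : ℂ)⁻¹ • fromBlocks 1 (-(I • 1)) 1 (I • 1)) : Matrix (Fin 2 ⊕ Fin 2) (Fin 2 ⊕ Fin 2) ℂ)))ᴴ * Matrix.J (Fin 2) ℂ * (h * NormedSpace.exp (τ • (fromBlocks 1 1 (I • 1) (-(I • 1)) * fromBlocks α β γ δ * ((2 : ℂ)⁻¹ • fromBlocks 1 (-(I • 1)) 1 (I • 1)) : Matrix (Fin 2 ⊕ Fin 2) (Fin 2 ⊕ Fin 2) ℂ))) = Matrix.J (Fin 2) ℂ :=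
      mul_mem_UJ hh (conjTranspose_exp_mul_J_mul_exp hX τ)
    have hVpos : ((2 * I)⁻¹ • (moeb (h * NormedSpace.exp (τ • (fromBlocks 1 1 (I • 1) (-(I • 1)) * fromBlocks α β γ δ * ((2 : ℂ)⁻¹ • fromBlocks 1 (-(I • 1)) 1 (I • 1)) : Matrix (Fin 2 ⊕ Fin 2) (Fin 2 ⊕ Fin 2) ℂ))) (I • (1 : Matrix (Fin 2) (Fin 2) ℂ)) - (moeb (h * NormedSpace.exp (τ • (fromBlocks 1 1 (I • 1) (-(I • 1)) * fromBlocks α β γ δ * ((2 : ℂ)⁻¹ • fromBlocks 1 (-(I • 1)) 1 (I • 1)) : Matrix (Fin 2 ⊕ Fin 2) (Fin 2 ⊕ Fin 2) ℂ))) (I • (1 : Matrix (Fin 2) (Fin 2) ℂ)))ᴴ)).PosDef :=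
      posDef_im_moeb hhτ posDef_im_I_smul_one
    have h2V := hVpos.smul (by norm_num : (0 : ℝ) < 2)
    rw [show ((2 : ℝ) • ((2 * I)⁻¹ • (moeb (h * NormedSpace.exp (τ • (fromBlocks 1 1 (I • 1) (-(I • 1)) * fromBlocks α β γ δ * ((2 : ℂ)⁻¹ • fromBlocks 1 (-(I • 1)) 1 (I • 1)) : Matrix (Fin 2 ⊕ Fin 2) (Fin 2 ⊕ Fin 2) ℂ))) (I • (1 : Matrix (Fin 2) (Fin 2) ℂ)) - (moeb (h * NormedSpace.exp (τ • (fromBlocks 1 1 (I • 1) (-(I • 1)) * fromBlocks α β γ δ * ((2 : ℂ)⁻¹ • fromBlocks 1 (-(I • 1)) 1 (I • 1)) : Matrix (Fin 2 ⊕ Fin 2) (Fin 2 ⊕ Fin 2) ℂ))) (I • (1 : Matrix (Fin 2) (Fin 2) ℂ)))ᴴ))) =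
      ((2 : ℂ) • ((2 * I)⁻¹ • (moeb (h * NormedSpace.exp (τ • (fromBlocks 1 1 (I • 1) (-(I • 1)) * fromBlocks α β γ δ * ((2 : ℂ)⁻¹ • fromBlocks 1 (-(I • 1)) 1 (I • 1)) : Matrix (Fin 2 ⊕ Fin 2) (Fin 2 ⊕ Fin 2) ℂ))) (I • (1 : Matrix (Fin 2) (Fin 2) ℂ)) - (moeb (h * NormedSpace.exp (τ • (fromBlocks 1 1 (I • 1) (-(I • 1)) * fromBlocks α β γ δ * ((2 : ℂ)⁻¹ • fromBlocks 1 (-(I • 1)) 1 (I • 1)) : Matrix (Fin 2 ⊕ Fin 2) (Fin 2 ⊕ Fin 2) ℂ))) (I • (1 : Matrix (Fin 2) (Fin 2) ℂ)))ᴴ))) by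
      rw [← Complex.coe_smul]; norm_num] at h2V
    have hg' := (Matrix.IsUnit.posDef_star_left_conjugate_iff (x := (2 : ℂ) • ((2 * I)⁻¹ • (moeb (h * NormedSpace.exp (τ • (fromBlocks 1 1 (I • 1) (-(I • 1)) * fromBlocks α β γ δ * ((2 : ℂ)⁻¹ • fromBlocks 1 (-(I • 1)) 1 (I • 1)) : Matrix (Fin 2 ⊕ Fin 2) (Fin 2 ⊕ Fin 2) ℂ))) (I • (1 : Matrix (Fin 2) (Fin 2) ℂ)) -
      (moeb (h * NormedSpace.exp (τ • (fromBlocks 1 1 (I • 1) (-(I • 1)) * fromBlocks α β γ δ * ((2 : ℂ)⁻¹ • fromBlocks 1 (-(I • 1)) 1 (I • 1)) : Matrix (Fin 2 ⊕ Fin 2) (Fin 2 ⊕ Fin 2) ℂ))) (I • (1 : Matrix (Fin 2) (Fin 2) ℂ)))ᴴ))) haU)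
    rw [Matrix.star_eq_conjTranspose] at hg'
    exact twistedArchBlock_scalarType_eq_continued_neg k hhτ hdet ht hN (hermTwo_eq_of_isHermitian (hg'.mpr h2V).1) Φ hΦa hΦb hs
  have hray' := hray.congr_of_eventuallyEq (Filter.Eventually.of_forall fun τ => heq τ)
  -- (4) uniqueness of the derivative
  exact hswap.unique hray'

end Summit.HodgeConjecture.HodgeConjecture.Cruxes.HLiu418.K2LiuArchTwistedKTypeBlockRungNeg

end
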